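import Literature.AlgebraicGeometry.ShimuraVarieties.UnitaryCurveAuxiliarySymplecticAdelicV
import Literature.AlgebraicGeometry.ShimuraVarieties.UnitaryAuxiliarySymplecticRationalPoints
import HarnessLib

/-!
# Rational points of the `V`-block auxiliary symplectic embedding: injectivity on the unitary slice and rational descent

Topic `AlgebraicGeometry/ShimuraVarieties`; namespace `Literature.AlgebraicGeometry.ShimuraVarieties.UnitaryCurve.AuxV`.
THEOREMS ONLY (no `def`, no named fact, no instance, no `sorry`).  Cell `hodgecm-mathlib`, crux HLiu418 (stmt-HodgeConjecture-24832),
sub-line P6a, E-line `F0_P6a_PELWitnessE`; organ E1 FILE 4 (asked by A-p17 (g27) 2026-09-01T21:58:07Z «`hbrat` + `ũ` injective are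
E1-currency»): the two group-theoretic inputs of [Deligne1971TravauxShimura] Prop. 1.15 for the `W₀`-FREE group map of ★
`UnitaryCurveAuxiliarySymplecticAdelicV` read on the UNITARY SLICE `t = 1`, `b := ũ_V(·, 1) : U(H)(𝔸_{L⁺,f}) → GSp_δ(𝔸_{ℚ,f})`,
`bq := ũ_V(·, 1) : U(H)(L⁺) → GSp_δ(ℚ)` — exactly the hypotheses `hbrat` (rational points of the image) of ★
`UnitaryCurve.gs_mk_eq_of_forall_siegel_mk_eq` (`UnitaryCurveSiegelPointSeparation`) and the injectivity behind it.  Rank-generic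
twin of ★ `UnitaryAuxiliarySymplecticRationalPoints` (§1 `auxToGspFin_injective`, §3 `exists_auxToGspRat_eq_of_gspRationalToFinAdelic_eq`),
whose rank-free §2 (descent along `ℚ → R` in the coordinates `1 ⊗ b_k`) is REUSED by name.

NOTE (why the slice).  Without the `W₀`-line the full map `ũ_V : (t, X) ↦ β⁻¹ · res(t·X) · β` is NOT injective on `T₀ × U(H)`
(`(t z, z⁻¹ X)` for a unitary scalar `z` has the same image); on the unitary slice `t = 1` it is (`res` and the frame conjugation are
injective), and that slice is what the curve's point map `[v, aK] ↦ [J(v), ũ_V(a, 1)]` uses.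

* §1 `unitaryToTensorFin_injective` (rank `n`), `auxToGspFinV_one_injective` — `a ↦ ũ_V(a, 1)` is injective on `U(H)(𝔸_f)`.
* §2 `exists_auxToGspRatV_eq_of_gspRationalToFinAdelic_eq` — RATIONAL DESCENT on the slice: if `ũ_V(a, 1)` is the diagonal image of a
  rational similitude `γ ∈ GSp_δ(ℚ)`, then `a = (γ₀)_𝔸` for a rational unitary `γ₀` with `ũ_V(γ₀, 1) = γ` ([Deligne1971TravauxShimura]
  1.15.3: `u(G₁(𝔸_f)) ∩ G₂(ℚ) = u(G₁(ℚ))`); `hbrat_auxToGspFinV` — the same in the binder shape of ★ `gs_mk_eq_of_forall_siegel_mk_eq`.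

HC_CM is proved only modulo the 2 remaining named inputs (hLiu418 24832, h413 24833) until rung 0 closes; this file discharges neither
(count-neutral support of 24832).

## References
* [Deligne1971TravauxShimura] P. Deligne, *Travaux de Shimura*, Sém. Bourbaki 389 (1971), Prop. 1.15 and 1.15.3 p. 132; 4.9 p. 148.
* [Deligne1979ShimuraVarieties] P. Deligne, *Variétés de Shimura* (1979), Prop. 2.3.10 (PDF p. 32).
* [RapoportSmithlingZhang2020Diagonal] M. Rapoport, B. Smithling, W. Zhang (2020), §3.2 and Prop. 3.7 (proof) pp. 11–14.
* [CasselsFrohlichANT1967] J. W. S. Cassels, A. Fröhlich (eds.), *Algebraic Number Theory* (1967), Ch. II §14.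
-/

set_option autoImplicit false

noncomputable section

open Matrix NumberField IsDedekindDomain
open scoped TensorProduct

namespace Literature.AlgebraicGeometry.ShimuraVarieties

namespace UnitaryCurve

namespace AuxV

open Literature.AlgebraicGeometry.ModuliOfAbelianVarieties
open Literature.AlgebraicGeometry.ShimuraVarieties.UnitaryCanonicalModel.Aux (torusRat torusFinAdelic toTorusFinAdelic ratBasis
  finAdeleToTensor torusToTensorFin ratToTensor torusToTensorRat resGL_injective conjRect_injective finAdeleToTensor_injective
  exists_eq_map_one_tmul_of_resMatrix_eq_map exists_eq_one_tmul_of_map_eq_one_tmul gspRationalToFinAdelic_injective)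
open Literature.AlgebraicGeometry.ShimuraVarieties.UnitaryCurve.Aux (unitaryToTensorFin unitaryToTensorRat)
open Literature.NumberTheory.ComplexMultiplication (ratFiniteAdeleTensorEquiv ratFiniteAdeleTensorEquiv_one_tmul)
open Literature.NumberTheory.Automorphic Literature.NumberTheory.Automorphic.UnitaryGroup

/-! ### §1. Injectivity on the unitary slice -/

section Injective

variable {L : Type} [Field L] [NumberField L] [IsCMField L] (M : Type) [Field M] [NumberField M] [IsCMField M]
  (j : L →+* M) {n : ℕ} (H : Matrix (Fin n) (Fin n) L)

omit [IsCMField M] in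
/-- The transport `U(H)(𝔸_f) → GL_n(𝔸_{ℚ,f} ⊗ M)` is injective (rank `n`; `1 ⊗ j` is injective by flatness, ★ `finAdeleToTensor_injective`).
[cite: Deligne1979ShimuraVarieties, Prop. 2.3.10 (PDF p. 32)] -/
theorem unitaryToTensorFin_injective : Function.Injective (UnitaryCurve.Aux.unitaryToTensorFin (n := n) M j H) := by
  intro a a' h
  refine Subtype.ext (Units.ext (Matrix.map_injective (finAdeleToTensor_injective M j)
    (congrArg (fun g : GL (Fin n) (finAdeleQ ⊗[ℚ] M) => (g : Matrix (Fin n) (Fin n) (finAdeleQ ⊗[ℚ] M))) h)))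

variable {M j H} {ξ : M} {g : ℕ} {δ : Fin g → ℕ}

/-- **`a ↦ ũ_V(a, 1)` is injective on `U(H)(𝔸_f)`** (the frame conjugation ★ `conjRect_injective` and the restriction of scalars ★
`resGL_injective` are injective, `blockGLV (1, X) = X`, and `unitaryToTensorFin` is injective). [cite: Deligne1979ShimuraVarieties, Prop. 2.3.10 (PDF p. 32)]
[cite: Deligne1971TravauxShimura, Prop. 1.15 p. 132] -/
theorem auxToGspFinV_one_injective (F : SymplecticFrameV M j H ξ g δ) :
    Function.Injective fun a : ↥(finAdelic (↥(maximalRealSubfield L)) L (IsCMField.complexConj L) n H) => auxToGspFinV F (a, 1) := by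
  intro a a' h
  have h' := congrArg Subtype.val h
  simp only [coe_auxToGspFinV, map_one, auxRepV, MonoidHom.comp_apply] at h'
  have h2 := resGL_injective _ (conjRect_injective _ _ _ _ h')
  have h3 := congrArg (fun u : GL (Fin n) (finAdeleQ ⊗[ℚ] M) => (u : Matrix (Fin n) (Fin n) (finAdeleQ ⊗[ℚ] M))) h2
  simp only [coe_blockGLV, Units.val_one, one_smul] at h3
  exact unitaryToTensorFin_injective M j H (Units.ext h3)

end Injective

/-! ### §2. Rational descent on the slice: `ũ_V(U(H)(𝔸_f), 1) ∩ GSp_δ(ℚ) = ũ_V(U(H)(L⁺), 1)` -/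

section RationalPoints

/-- There is a finite prime of a number field (`𝓞 K` is not a field). [folklore] -/
private theorem nonempty_heightOneSpectrum' (K : Type) [Field K] [NumberField K] : Nonempty (HeightOneSpectrum (𝓞 K)) := by
  obtain ⟨P, hP⟩ := Ideal.exists_maximal (𝓞 K)
  exact ⟨⟨P, hP.isPrime, Ring.ne_bot_of_isMaximal_of_not_isField hP (RingOfIntegers.not_isField K)⟩⟩

/-- `K → 𝔸_{K,f}` is injective (read at one finite place). [folklore] -/
private theorem algebraMap_finiteAdeleRing_injective' (K : Type) [Field K] [NumberField K] :
    Function.Injective (algebraMap K (FiniteAdeleRing (𝓞 K) K)) := by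
  obtain ⟨v⟩ := nonempty_heightOneSpectrum' K
  intro x y hxy
  have h := congrArg (fun z : FiniteAdeleRing (𝓞 K) K => z v) hxy
  simp only [FiniteAdeleRing.algebraMap_apply] at h
  exact (algebraMap K (v.adicCompletion K)).injective h

variable {L : Type} [Field L] [NumberField L] [IsCMField L] {M : Type} [Field M] [NumberField M] [IsCMField M]
  {j : L →+* M} {n : ℕ} {H : Matrix (Fin n) (Fin n) L} {ξ : M} {g : ℕ} {δ : Fin g → ℕ}

/-- **Rational descent for `ũ_V` on the unitary slice** (hypothesis 1.15.3 of Deligne's injectivity criterion for the `W₀`-free auxiliary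
embedding of [RapoportSmithlingZhang2020Diagonal] §3.2): if the finite-adelic image `ũ_V(a, 1)` of `a ∈ U(H)(𝔸_f)` is (the diagonal image of) a
rational similitude `γ ∈ GSp_δ(ℚ)`, then `a = (γ₀)_{𝔸_f}` for a rational unitary `γ₀ ∈ U(H)(L⁺)` with `ũ_V(γ₀, 1) = γ`.  Proof (★ rank-3 road,
torus step deleted): `Q γ P` is a rational matrix equal to the restriction of scalars of `â` over `𝔸_{ℚ,f} ⊗ M`, so `â = 1 ⊗ A₀` (★
`exists_eq_map_one_tmul_of_resMatrix_eq_map`); the entries of `a` descend along `1 ⊗ j` (★ `exists_eq_one_tmul_of_map_eq_one_tmul`), unitarity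
along the injective `L → 𝔸_{L,f}`; finally `ũ_V(γ₀, 1) = γ` by the square ★ `gspRationalToFinAdelic_auxToGspRatV` and injectivity of the diagonal.
[cite: Deligne1971TravauxShimura, Prop. 1.15 p. 132, 1.15.3; 4.9 p. 148] [cite: Deligne1979ShimuraVarieties, Prop. 2.3.10 (PDF p. 32)] -/
theorem exists_auxToGspRatV_eq_of_gspRationalToFinAdelic_eq (F : SymplecticFrameV M j H ξ g δ) {γ : ↥(gspRational δ)}
    {a : ↥(finAdelic (↥(maximalRealSubfield L)) L (IsCMField.complexConj L) n H)}
    (h : gspRationalToFinAdelic δ γ = auxToGspFinV F (a, 1)) :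
    ∃ γ₀ : ↥(rational (↥(maximalRealSubfield L)) L (IsCMField.complexConj L) n H),
      rationalToFinAdelic (↥(maximalRealSubfield L)) L (IsCMField.complexConj L) n H γ₀ = a ∧ auxToGspRatV F (γ₀, 1) = γ := by
  haveI : Nontrivial (FiniteAdeleRing (𝓞 L) L) := (algebraMap_finiteAdeleRing_injective' L).nontrivial
  -- (S1) the equation in `GL_{2g}(𝔸_{ℚ,f})`, then in matrices
  have hGL : Matrix.GeneralLinearGroup.map (algebraMap ℚ finAdeleQ) (γ : GL (Fin g ⊕ Fin g) ℚ) =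
      auxRepV finAdeleQ F (1, unitaryToTensorFin M j H a) := by
    have h' := congrArg Subtype.val h
    rwa [coe_gspRationalToFinAdelic, coe_auxToGspFinV, map_one] at h'
  have hmat : (((γ : GL (Fin g ⊕ Fin g) ℚ) : Matrix (Fin g ⊕ Fin g) (Fin g ⊕ Fin g) ℚ).map (algebraMap ℚ finAdeleQ)) =
      framePVR finAdeleQ F *
        resMatrix (Algebra.TensorProduct.basis finAdeleQ (ratBasis M))
          ((unitaryToTensorFin M j H a : GL (Fin n) (finAdeleQ ⊗[ℚ] M)) : Matrix (Fin n) (Fin n) (finAdeleQ ⊗[ℚ] M)) *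
        frameQVR finAdeleQ F := by
    have h' := congrArg (fun u : GL (Fin g ⊕ Fin g) finAdeleQ => (u : Matrix (Fin g ⊕ Fin g) (Fin g ⊕ Fin g) finAdeleQ)) hGL
    rw [auxRepV, MonoidHom.comp_apply, MonoidHom.comp_apply, coe_conjRect, coe_resGL, coe_blockGLV, Units.val_one, one_smul] at h'
    exact h'
  -- (S2) `Q γ P` is rational and equals the restriction of scalars of `â`
  have hres : resMatrix (Algebra.TensorProduct.basis finAdeleQ (ratBasis M))
        ((unitaryToTensorFin M j H a : GL (Fin n) (finAdeleQ ⊗[ℚ] M)) : Matrix (Fin n) (Fin n) (finAdeleQ ⊗[ℚ] M)) =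
      (frameQV F * ((γ : GL (Fin g ⊕ Fin g) ℚ) : Matrix (Fin g ⊕ Fin g) (Fin g ⊕ Fin g) ℚ) * framePV F).map
        (algebraMap ℚ finAdeleQ) := by
    rw [Matrix.map_mul, Matrix.map_mul, hmat]
    change _ = frameQVR finAdeleQ F * (framePVR finAdeleQ F * _ * frameQVR finAdeleQ F) * framePVR finAdeleQ F
    rw [show ∀ X : Matrix (Fin n × Fin (Module.finrank ℚ M)) (Fin n × Fin (Module.finrank ℚ M)) finAdeleQ,
        frameQVR finAdeleQ F * (framePVR finAdeleQ F * X * frameQVR finAdeleQ F) * framePVR finAdeleQ F =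
          (frameQVR finAdeleQ F * framePVR finAdeleQ F) * X * (frameQVR finAdeleQ F * framePVR finAdeleQ F) from
        fun X => by simp only [Matrix.mul_assoc], frameQVR_mul_framePVR, Matrix.one_mul, Matrix.mul_one]
  -- (S3) matrix descent: `â = 1 ⊗ A₀`
  obtain ⟨A₀, hA₀⟩ := exists_eq_map_one_tmul_of_resMatrix_eq_map _ _ hres
  have hX' : ∀ i k, ((unitaryToTensorFin M j H a : GL (Fin n) (finAdeleQ ⊗[ℚ] M)) : Matrix (Fin n) (Fin n) (finAdeleQ ⊗[ℚ] M)) i k =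
      (1 : finAdeleQ) ⊗ₜ[ℚ] A₀ i k := fun i k => by
    have hik := congrFun (congrFun hA₀ i) k
    rw [Matrix.map_apply] at hik
    exact hik
  -- (S4) the entries of `a` descend along `1 ⊗ j`, then along `L → 𝔸_{L,f}`
  have hfa : ∀ i k, Algebra.TensorProduct.map (AlgHom.id finAdeleQ finAdeleQ) j.toRatAlgHom
      ((ratFiniteAdeleTensorEquiv L).symm
        ((((a : GL (Fin n) (FiniteAdeleRing (𝓞 L) L)) : Matrix (Fin n) (Fin n) (FiniteAdeleRing (𝓞 L) L)) i k))) =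
        (1 : finAdeleQ) ⊗ₜ[ℚ] A₀ i k := fun i k => by
    change finAdeleToTensor M j _ = _
    change ((unitaryToTensorFin M j H a : GL (Fin n) (finAdeleQ ⊗[ℚ] M)) : Matrix (Fin n) (Fin n) (finAdeleQ ⊗[ℚ] M)) i k = _
    exact hX' i k
  choose l hl using fun i k => exists_eq_one_tmul_of_map_eq_one_tmul j _ _ (hfa i k)
  have hal : ∀ i k, (((a : GL (Fin n) (FiniteAdeleRing (𝓞 L) L)) : Matrix (Fin n) (Fin n) (FiniteAdeleRing (𝓞 L) L)) i k) =
      algebraMap L (FiniteAdeleRing (𝓞 L) L) (l i k) := fun i k => by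
    rw [← ratFiniteAdeleTensorEquiv_one_tmul, ← hl i k, RingEquiv.apply_symm_apply]
  have haΛ : (((a : GL (Fin n) (FiniteAdeleRing (𝓞 L) L)) : Matrix (Fin n) (Fin n) (FiniteAdeleRing (𝓞 L) L))) =
      (Matrix.of l).map (algebraMap L (FiniteAdeleRing (𝓞 L) L)) := by
    funext i k
    rw [Matrix.map_apply, Matrix.of_apply]
    exact hal i k
  have hdet : (Matrix.of l).det ≠ 0 := by
    intro h0
    have hu : IsUnit ((((a : GL (Fin n) (FiniteAdeleRing (𝓞 L) L)) : Matrix (Fin n) (Fin n) (FiniteAdeleRing (𝓞 L) L))).det) :=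
      ⟨Matrix.GeneralLinearGroup.det (a : GL (Fin n) (FiniteAdeleRing (𝓞 L) L)), rfl⟩
    rw [haΛ, ← RingHom.mapMatrix_apply, ← RingHom.map_det, h0, map_zero] at hu
    exact not_isUnit_zero hu
  let γ₁ : GL (Fin n) L := Matrix.GeneralLinearGroup.mkOfDetNeZero (Matrix.of l) hdet
  have hγ₁ : ((γ₁ : GL (Fin n) L) : Matrix (Fin n) (Fin n) L) = Matrix.of l := rfl
  have hmapγ : Matrix.GeneralLinearGroup.map (algebraMap L (FiniteAdeleRing (𝓞 L) L)) γ₁ =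
      (a : GL (Fin n) (FiniteAdeleRing (𝓞 L) L)) := by
    apply Units.ext
    change (((γ₁ : GL (Fin n) L) : Matrix (Fin n) (Fin n) L)).map (algebraMap L (FiniteAdeleRing (𝓞 L) L)) = _
    rw [hγ₁, haΛ]
  -- unitarity descends along the injective `L → 𝔸_{L,f}`
  have hmem : γ₁ ∈ rational (↥(maximalRealSubfield L)) L (IsCMField.complexConj L) n H := by
    rw [rational, mem_unitaryGroupOfForm_iff, hγ₁]
    have hu := (mem_finAdelic_iff (↥(maximalRealSubfield L)) L (IsCMField.complexConj L) n H
      (a : GL (Fin n) (FiniteAdeleRing (𝓞 L) L))).1 a.2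
    rw [haΛ] at hu
    apply Matrix.map_injective (algebraMap_finiteAdeleRing_injective' L)
    have hconj : ((Matrix.of l).map (algebraMap L (FiniteAdeleRing (𝓞 L) L))).map
        (conjFiniteAdele (↥(maximalRealSubfield L)) L (IsCMField.complexConj L)) =
          ((Matrix.of l).map ((IsCMField.complexConj L : L ≃ₐ[↥(maximalRealSubfield L)] L) : L →+* L)).map
            (algebraMap L (FiniteAdeleRing (𝓞 L) L)) := by
      funext i k
      simp only [Matrix.map_apply]
      rw [← algebraMap_galConj_finiteAdele (↥(maximalRealSubfield L)) L (IsCMField.complexConj L)]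
    have hform : finiteAdelicForm L n H = H.map (algebraMap L (FiniteAdeleRing (𝓞 L) L)) := rfl
    rw [hconj, hform, ← Matrix.transpose_map, ← Matrix.map_mul, ← Matrix.map_mul] at hu
    simpa only using hu
  -- (S5) assemble and compare through the injective diagonal `GSp_δ(ℚ) → GSp_δ(𝔸_{ℚ,f})`
  have hγ₀ : rationalToFinAdelic (↥(maximalRealSubfield L)) L (IsCMField.complexConj L) n H ⟨γ₁, hmem⟩ = a :=
    Subtype.ext (by rw [coe_rationalToFinAdelic]; exact hmapγ)
  refine ⟨⟨γ₁, hmem⟩, hγ₀, gspRationalToFinAdelic_injective δ ?_⟩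
  rw [gspRationalToFinAdelic_auxToGspRatV, map_one, hγ₀, h]

/-- **`hbrat` for `b := ũ_V(·, 1)`** — the rational-points hypothesis of ★ `UnitaryCurve.gs_mk_eq_of_forall_siegel_mk_eq` in its exact binder
shape: `(γ)_𝔸 = ũ_V(x, 1) ⇒ ∃ β, x = β_𝔸 ∧ γ = ũ_V(β, 1)`. [cite: Deligne1971TravauxShimura, Prop. 1.15 p. 132, 1.15.3] -/
theorem hbrat_auxToGspFinV (F : SymplecticFrameV M j H ξ g δ) (γ : ↥(gspRational δ))
    (x : ↥(finAdelic (↥(maximalRealSubfield L)) L (IsCMField.complexConj L) n H))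
    (h : gspRationalToFinAdelic δ γ = auxToGspFinV F (x, 1)) :
    ∃ β : ↥(rational (↥(maximalRealSubfield L)) L (IsCMField.complexConj L) n H),
      x = rationalToFinAdelic (↥(maximalRealSubfield L)) L (IsCMField.complexConj L) n H β ∧ γ = auxToGspRatV F (β, 1) := by
  obtain ⟨γ₀, h₁, h₂⟩ := exists_auxToGspRatV_eq_of_gspRationalToFinAdelic_eq F h
  exact ⟨γ₀, h₁.symm, h₂.symm⟩

end RationalPoints

end AuxV

end UnitaryCurve

end Literature.AlgebraicGeometry.ShimuraVarieties

end
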